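import Literature.Computability.AlgebraicComplexity.FlipGraph222StdComponentCanon3
import Literature.Computability.AlgebraicComplexity.FlipGraph222StdComponentReductions
import HarnessLib

/-!
# The flip edges of the standard algorithm's component (`(2,2,2)`, `ℤ₂`; KM 2023 §4: "1183 edges")

Topic `Literature/Computability/AlgebraicComplexity`. Source: M. Kauers, J. Moosbauer, *Flip Graphs
for Matrix Multiplication*, ISSAC 2023 = arXiv:2212.01175 (KM), §4 / Fig. 1, on `K = ℤ₂`: the
connected component of the standard algorithm in the `(2,2,2)`-flip graph of rank at most `8` "has
`272` vertices … and `1183` edges, `7` of which are reductions". Def. 8: vertices = orbits under the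
symmetry group `G`, edges `E₁` (flips, Def. 4) `∪ E₂` (reductions, Prop. 3) induced from
representatives.

## What is typed (everything PROVED, kernel replay; no named facts)

With the `273` representatives `creps` (their orbits ARE the component and are pairwise distinct:
`kauersMoosbauer2023_fig1_component_eq`, `cv_injective`), the flip→orbit certificate `cwits` of
`FlipGraph222StdComponent.lean`, the complete flip enumerator `Cert222.flipsAll`
(`exists_mem_flipsAll_of_flips`, `Cert222R.flips_of_mem_flipsAll`) and the reduction edges of
`FlipGraph222StdComponentReductions.lean`:

* `flipTgtList i` (definition): the target indices of the non-degenerate flips of `creps[i]`, read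
  off the certificate; `flip_edge_iff`: there is an `E₁`-edge `cv i → cv j` (a scheme of the orbit
  `cv i` has a FLIP in the orbit `cv j`; `i = j` allowed — a loop) iff `j ∈ flipTgtList i`;
* `flipGraphKM_cv_iff`: the complete edge table of KM's directed flip graph on the component, and
  `flipTgt_symm` (flips are reversible), `adj_cv_iff`: adjacency of the undirected simple graph
  `flipGraph222LE8` between listed vertices;
* the COUNTS (kernel evaluation over the `273 · 273` index pairs): `1136` unordered pairs of
  distinct vertices joined by a flip (`flipPairs_card`), `40` vertices carrying a flip loop
  (`flipLoops_card`), and `1144 = 1136 + 8` unordered adjacent pairs of distinct vertices of the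
  component in `flipGraph222LE8` (`adjPairs_card`; the `8` are the reduction edges).
  KM's printed `1183 = 1176 + 7` counts flips as `1136` pairs `+ 40` loops `= 1176` (reproduced
  exactly) and `7` reductions (kernel: `8`, `reduction_sources`).

HONEST FRAMING: statements about `⟨2,2,2⟩` over `ℤ₂`, KM's group `G`, KM's flips (Def. 4, both
choices of the modified tensor, all slots) and reductions (Prop. 3); the loop convention (`40`) is
KM's data convention (one edge per orbit having a flip into itself), read against their published
edge list, not a printed definition.

## References

* M. Kauers, J. Moosbauer, *Flip Graphs for Matrix Multiplication*, ISSAC 2023, 381–388,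
  doi:10.1145/3597066.3597120, arXiv:2212.01175: Def. 4, Prop. 3, Def. 8, Thm. 9, §4 and Fig. 1
  ("272 vertices … 1183 edges, 7 of which are reductions"). [KauersMoosbauer2022FlipGraphs]
-/

set_option Elab.async false

namespace Literature.Computability.AlgebraicComplexity

open scoped BigOperators Kronecker
open Multiset Matrix

namespace FlipGraph

namespace Comp222

open Cert222 Cert222R StdBall222 Hidden222 Canon222

/-! ## §1 The flip-target table read off the certificate -/

/-- The target indices of the non-degenerate flips of representative `i`: the flip results
`flipsAll creps[i]` zipped with their certificate witnesses `cwits[i]` (target index, word), the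
degenerate results (a zero factor: not a scheme) dropped. [cite: KauersMoosbauer2022FlipGraphs, Def. 4, Def. 8] -/
def flipTgtList (i : ℕ) : List ℕ :=
  (((flipsAll (creps.getD i [])).zip (cwits.getD i [])).filter fun p => !hasZeroB p.1).map
    fun p => p.2.1

/-- Positional soundness of `allMatchB` on a zipped prefix (bookkeeping). [folklore] -/
private theorem allMatchB_zip {reps : List (List Tri)} {bound : ℕ} (rs' : List (List Tri)) :
    ∀ (rs : List (List Tri)) (ws : List W), allMatchB reps bound (rs ++ rs') ws = true →
      ∀ p ∈ rs.zip ws, matchB reps bound p.1 p.2 = true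
  | [], _, _ => by simp
  | r :: rs, [], h => by simp [allMatchB] at h
  | r :: rs, w :: ws, h => by
    simp only [List.cons_append, allMatchB, Bool.and_eq_true] at h
    intro p hp
    simp only [List.zip_cons_cons, List.mem_cons] at hp
    rcases hp with rfl | hp
    · exact h.1
    · exact allMatchB_zip rs' rs ws h.2 p hp

/-- Every entry of the prefix is zipped with some witness (bookkeeping). [folklore] -/
private theorem exists_zip_of_mem {reps : List (List Tri)} {bound : ℕ} (rs' : List (List Tri)) :
    ∀ (rs : List (List Tri)) (ws : List W), allMatchB reps bound (rs ++ rs') ws = true →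
      ∀ r ∈ rs, ∃ w, (r, w) ∈ rs.zip ws
  | [], _, _ => by simp
  | r :: rs, [], h => by simp [allMatchB] at h
  | r :: rs, w :: ws, h => by
    simp only [List.cons_append, allMatchB, Bool.and_eq_true] at h
    intro r' hr'
    rcases List.mem_cons.mp hr' with rfl | hr'
    · exact ⟨w, by simp⟩
    · obtain ⟨w', hw'⟩ := exists_zip_of_mem rs' rs ws h.2 r' hr'
      exact ⟨w', by simp [hw']⟩

/-- Two schemes with the same elements are equal (bookkeeping). [folklore] -/
private theorem scheme_ext'' {t₀ : T} {x y : Scheme t₀} (h : x.elts = y.elts) : x = y := by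
  cases x; cases y; cases h; rfl

/-- A code list with all codes `< 16` and no zero code is well formed (bookkeeping). [folklore] -/
private theorem wfL_of_bdB_of_hasZeroB {r : List Tri} (hbd : ∀ t ∈ r, bdB t = true)
    (hz : hasZeroB r = false) : wfL r = true := by
  simp only [wfL, List.all_eq_true]
  intro t ht
  have hb := hbd t ht
  simp only [bdB, Bool.and_eq_true, decide_eq_true_eq] at hb
  have hz' : ¬ (t.1 = 0 ∨ t.2.1 = 0 ∨ t.2.2 = 0) := by
    intro h0
    have : hasZeroB r = true := by
      simp only [hasZeroB, List.any_eq_true]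
      exact ⟨t, ht, by simpa [Bool.or_eq_true, beq_iff_eq, or_assoc] using h0⟩
    rw [hz] at this
    exact Bool.false_ne_true this
  simp only [wfT, wfC, Bool.and_eq_true, decide_eq_true_eq]
  omega

/-- The certificate of representative `i`, unpacked (bookkeeping). [cite: KauersMoosbauer2022FlipGraphs, §4] -/
private theorem cert_i (i : Fin 273) :
    wfL (creps.getD i.val []) = true ∧
      allMatchB creps 273 (flipsAll (creps.getD i.val []) ++ mergesAll (creps.getD i.val []))
        (cwits.getD i.val []) = true := by
  have h := closureB_all i.val i.isLt
  simp only [closureB, Bool.and_eq_true] at h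
  exact ⟨h.1.1, h.2⟩

/-! ## §2 The flip edges are exactly the table -/

/-- **Only the tabulated flips:** if a scheme of the orbit `cv i` flips to a scheme of the orbit
`cv j`, then `j ∈ flipTgtList i` (equivariance, completeness of the flip enumerator, the
certificate, distinctness of the listed orbits). [cite: KauersMoosbauer2022FlipGraphs, Def. 4, Def. 8 (`E₁`), §4 ("1183 edges")] -/
theorem flip_edge_only (i j : Fin 273) {x y : Scheme (matMulTensor (ZMod 2) 2 2 2)}
    (hx : Quotient.mk (orbitSetoidKM (ZMod 2) 2) x = (cv i).1)
    (hy : Quotient.mk (orbitSetoidKM (ZMod 2) 2) y = (cv j).1) (hfl : Flips x.elts y.elts) :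
    j.val ∈ flipTgtList i.val := by
  obtain ⟨φ, hφ, hxφ⟩ : (orbitSetoidKM (ZMod 2) 2).r x (cs i) := Quotient.exact hx
  have h' : Flips (elts3 (creps.getD i.val [])) (y.map φ).elts := by
    rw [← cs_elts, hxφ]; exact hφ.map_flips hfl
  obtain ⟨hwf, hall⟩ := cert_i i
  obtain ⟨r, hr, hyr⟩ := exists_mem_flipsAll_of_flips hwf h'
  obtain ⟨w, hzw⟩ := exists_zip_of_mem _ _ _ hall r hr
  have hm := allMatchB_zip _ _ _ hall _ hzw
  have hz : hasZeroB r = false := hasZeroB_eq_false (y.map φ) hyr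
  obtain ⟨hlt, hg, hbd, hmatch⟩ := matchB_sound hm hz
  have hyw : ((y.map φ).map (symOf w.2)).elts = (cs ⟨w.1, hlt⟩).elts := by
    rw [Scheme.map_elts, hyr, map_symOf_elts3 _ hg r hbd, hmatch, cs_elts]
  have heq : cv j = cv ⟨w.1, hlt⟩ := by
    apply Subtype.ext
    show (cv j).1 = Quotient.mk _ (cs ⟨w.1, hlt⟩)
    rw [← hy]
    refine Quotient.sound ⟨φ.trans (symOf w.2), hφ.trans (inSymmetryGroup_symOf _), ?_⟩
    exact scheme_ext'' (by rw [Scheme.map_trans]; exact hyw.symm)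
  have hj : j.val = w.1 := congrArg Fin.val (cv_injective heq)
  simp only [flipTgtList, List.mem_map, List.mem_filter]
  exact ⟨(r, w), ⟨hzw, by simp [hz]⟩, hj.symm⟩

/-- **Every tabulated flip is an edge:** if `j ∈ flipTgtList i`, the representative `cs i` flips to a
scheme of the orbit `cv j`. [cite: KauersMoosbauer2022FlipGraphs, Def. 4, Def. 8 (`E₁`), §4 ("1183 edges")] -/
theorem flip_edge_of_mem (i j : Fin 273) (h : j.val ∈ flipTgtList i.val) :
    ∃ x y : Scheme (matMulTensor (ZMod 2) 2 2 2),
      Quotient.mk (orbitSetoidKM (ZMod 2) 2) x = (cv i).1 ∧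
      Quotient.mk (orbitSetoidKM (ZMod 2) 2) y = (cv j).1 ∧ Flips x.elts y.elts := by
  simp only [flipTgtList, List.mem_map, List.mem_filter] at h
  obtain ⟨⟨r, w⟩, ⟨hzw, hz⟩, hj⟩ := h
  obtain ⟨hwf, hall⟩ := cert_i i
  have hm := allMatchB_zip _ _ _ hall _ hzw
  have hz' : hasZeroB r = false := by simpa using hz
  obtain ⟨hlt, hg, hbd, hmatch⟩ := matchB_sound hm hz'
  have hr : r ∈ flipsAll (creps.getD i.val []) := (List.of_mem_zip hzw).1
  have hflip : Flips (elts3 (creps.getD i.val [])) (elts3 r) := flips_of_mem_flipsAll hr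
  have hwr : wfL r = true := wfL_of_bdB_of_hasZeroB hbd hz'
  have hsum : (elts3 r).sum = matMulTensor (ZMod 2) 2 2 2 := by
    rw [hflip.sum_eq, ← cs_elts]; exact (cs i).sum_eq
  refine ⟨cs i, schemeOf r hwr hsum, rfl, ?_, by rw [cs_elts]; exact hflip⟩
  have hj2 : w.1 = j.val := hj
  have hj' : j = ⟨w.1, hlt⟩ := Fin.ext hj2.symm
  rw [hj']
  refine Quotient.sound ⟨symOf w.2, inSymmetryGroup_symOf _, scheme_ext'' ?_⟩
  rw [Scheme.map_elts, cs_elts, ← hmatch]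
  exact (map_symOf_elts3 _ hg r hbd).symm

/-- **KM's flip edges `E₁` on the component, in the kernel:** between the vertices `cv i`, `cv j`
there is a flip edge of KM's flip graph (a scheme of the first orbit has a flip, Def. 4, in the
second orbit; loops `i = j` allowed) iff `j ∈ flipTgtList i`. [cite: KauersMoosbauer2022FlipGraphs, Def. 4, Def. 8 (`E₁`), §4 ("1183 edges")] -/
theorem flip_edge_iff (i j : Fin 273) :
    (∃ x y : Scheme (matMulTensor (ZMod 2) 2 2 2),
      Quotient.mk (orbitSetoidKM (ZMod 2) 2) x = (cv i).1 ∧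
      Quotient.mk (orbitSetoidKM (ZMod 2) 2) y = (cv j).1 ∧ Flips x.elts y.elts) ↔
    j.val ∈ flipTgtList i.val :=
  ⟨fun ⟨_, _, hx, hy, h⟩ => flip_edge_only i j hx hy h, flip_edge_of_mem i j⟩

/-! ## §3 The whole edge table and the counts -/

/-- **The flip table is symmetric** (flips are reversible, Def. 4). [cite: KauersMoosbauer2022FlipGraphs, Def. 4, Def. 8 (`E₁`), §4 ("1183 edges")] -/
theorem flipTgt_symm (i j : Fin 273) : j.val ∈ flipTgtList i.val ↔ i.val ∈ flipTgtList j.val := by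
  rw [← flip_edge_iff, ← flip_edge_iff]
  constructor
  · rintro ⟨x, y, hx, hy, h⟩
    exact ⟨y, x, hy, hx, h.symm⟩
  · rintro ⟨x, y, hx, hy, h⟩
    exact ⟨y, x, hy, hx, h.symm⟩

/-- **The directed edge table of KM's flip graph on the component:** `cv i → cv j` is an edge
(`E₁ ∪ E₂`, Def. 8) iff `j ∈ flipTgtList i` (a flip) or `j = 265 ∧ i` is one of the eight
reduction sources. [cite: KauersMoosbauer2022FlipGraphs, Def. 8, §4 (Fig. 1)] -/
theorem flipGraphKM_cv_iff (i j : Fin 273) :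
    flipGraphKM (ZMod 2) 2 (cv i).1 (cv j).1 ↔
      j.val ∈ flipTgtList i.val ∨ (j.val = 265 ∧ i.val ∈ ([262, 263, 264, 266, 267, 268, 269, 270] : List ℕ)) := by
  constructor
  · rintro ⟨x, y, hx, hy, hadj⟩
    rcases hadj with hfl | hred
    · exact Or.inl (flip_edge_only i j hx hy hfl)
    · exact Or.inr (reduction_edge_only i j hx hy hred)
  · rintro (h | h)
    · obtain ⟨x, y, hx, hy, hfl⟩ := flip_edge_of_mem i j h
      exact ⟨x, y, hx, hy, Or.inl hfl⟩
    · obtain ⟨x, y, hx, hy, hred⟩ := (reduction_edge_iff i j).mpr h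
      exact ⟨x, y, hx, hy, Or.inr hred⟩

/-- **Adjacency of the undirected graph `flipGraph222LE8` between listed vertices** (KM Def. 8 /
Thm. 9: an edge in either direction; no loops in a simple graph; the flip table being symmetric,
one direction of it suffices). [cite: KauersMoosbauer2022FlipGraphs, Def. 8, Thm. 9, §4 (Fig. 1)] -/
theorem adj_cv_iff (i j : Fin 273) :
    flipGraph222LE8.Adj (cv i) (cv j) ↔ i ≠ j ∧ (j.val ∈ flipTgtList i.val ∨
      (j.val = 265 ∧ i.val ∈ ([262, 263, 264, 266, 267, 268, 269, 270] : List ℕ)) ∨ (i.val = 265 ∧ j.val ∈ ([262, 263, 264, 266, 267, 268, 269, 270] : List ℕ))) := by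
  rw [flipGraph222LE8, SimpleGraph.fromRel_adj, flipGraphKM_cv_iff, flipGraphKM_cv_iff,
    cv_injective.ne_iff, ← flipTgt_symm i j]
  constructor
  · rintro ⟨hne, (h | h) | h | h⟩
    · exact ⟨hne, Or.inl h⟩
    · exact ⟨hne, Or.inr (Or.inl h)⟩
    · exact ⟨hne, Or.inl h⟩
    · exact ⟨hne, Or.inr (Or.inr h)⟩
  · rintro ⟨hne, h | h | h⟩
    · exact ⟨hne, Or.inl (Or.inl h)⟩
    · exact ⟨hne, Or.inl (Or.inr h)⟩
    · exact ⟨hne, Or.inr (Or.inr h)⟩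

/-- Flip-pair count, chunk 0 (`0 ≤ i < 23`; kernel evaluation). [cite: KauersMoosbauer2022FlipGraphs, Def. 4, Def. 8 (`E₁`), §4 ("1183 edges")] -/
theorem flipPairs_0 : ((List.range' 0 23).map fun i =>
    ((List.range' 0 273).filter fun j => i < j ∧ j ∈ flipTgtList i).length).sum = 191 := by
  decide +kernel

/-- Flip-pair count, chunk 1 (`23 ≤ i < 46`; kernel evaluation). [cite: KauersMoosbauer2022FlipGraphs, Def. 4, Def. 8 (`E₁`), §4 ("1183 edges")] -/
theorem flipPairs_1 : ((List.range' 23 23).map fun i =>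
    ((List.range' 0 273).filter fun j => i < j ∧ j ∈ flipTgtList i).length).sum = 167 := by
  decide +kernel

/-- Flip-pair count, chunk 2 (`46 ≤ i < 92`; kernel evaluation). [cite: KauersMoosbauer2022FlipGraphs, Def. 4, Def. 8 (`E₁`), §4 ("1183 edges")] -/
theorem flipPairs_2 : ((List.range' 46 46).map fun i =>
    ((List.range' 0 273).filter fun j => i < j ∧ j ∈ flipTgtList i).length).sum = 226 := by
  decide +kernel

/-- Flip-pair count, chunk 3 (`92 ≤ i < 138`; kernel evaluation). [cite: KauersMoosbauer2022FlipGraphs, Def. 4, Def. 8 (`E₁`), §4 ("1183 edges")] -/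
theorem flipPairs_3 : ((List.range' 92 46).map fun i =>
    ((List.range' 0 273).filter fun j => i < j ∧ j ∈ flipTgtList i).length).sum = 218 := by
  decide +kernel

/-- Flip-pair count, chunk 4 (`138 ≤ i < 184`; kernel evaluation). [cite: KauersMoosbauer2022FlipGraphs, Def. 4, Def. 8 (`E₁`), §4 ("1183 edges")] -/
theorem flipPairs_4 : ((List.range' 138 46).map fun i =>
    ((List.range' 0 273).filter fun j => i < j ∧ j ∈ flipTgtList i).length).sum = 173 := by
  decide +kernel

/-- Flip-pair count, chunk 5 (`184 ≤ i < 230`; kernel evaluation). [cite: KauersMoosbauer2022FlipGraphs, Def. 4, Def. 8 (`E₁`), §4 ("1183 edges")] -/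
theorem flipPairs_5 : ((List.range' 184 46).map fun i =>
    ((List.range' 0 273).filter fun j => i < j ∧ j ∈ flipTgtList i).length).sum = 119 := by
  decide +kernel

/-- Flip-pair count, chunk 6 (`230 ≤ i < 273`; kernel evaluation). [cite: KauersMoosbauer2022FlipGraphs, Def. 4, Def. 8 (`E₁`), §4 ("1183 edges")] -/
theorem flipPairs_6 : ((List.range' 230 43).map fun i =>
    ((List.range' 0 273).filter fun j => i < j ∧ j ∈ flipTgtList i).length).sum = 42 := by
  decide +kernel

/-- Splitting the index range into the seven chunks (bookkeeping). [folklore] -/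
private theorem range273_split : List.range 273 = List.range' 0 23 ++ List.range' 23 23 ++ List.range' 46 46 ++ List.range' 92 46 ++ List.range' 138 46 ++ List.range' 184 46 ++ List.range' 230 43 := by
  decide +kernel

/-- **`1136` unordered pairs `i < j` of distinct vertices of the component are joined by a flip**
(by `flipTgt_symm` the direction does not matter; the seven kernel chunks). KM's data list these as
`2272` ordered pairs. [cite: KauersMoosbauer2022FlipGraphs, Def. 4, Def. 8 (`E₁`), §4 ("1183 edges")] -/
theorem flipPairs_card : ((List.range 273).map fun i =>
    ((List.range' 0 273).filter fun j => i < j ∧ j ∈ flipTgtList i).length).sum = 1136 := by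
  rw [range273_split]
  simp only [List.map_append, List.sum_append, flipPairs_0, flipPairs_1, flipPairs_2, flipPairs_3,
    flipPairs_4, flipPairs_5, flipPairs_6]

/-- **`40` vertices of the component carry a flip loop** (a flip of a scheme into its own orbit;
KM's edge data count one edge per such orbit; kernel evaluation). [cite: KauersMoosbauer2022FlipGraphs, Def. 4, Def. 8 (`E₁`), §4 ("1183 edges")] -/
theorem flipLoops_card : ((List.range 273).filter fun i => i ∈ flipTgtList i).length = 40 := by
  decide +kernel

/-- Adjacent-pair count, chunk 0 (`0 ≤ i < 23`; kernel evaluation). [cite: KauersMoosbauer2022FlipGraphs, §4 ("1183 edges")] -/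
theorem adjPairs_0 : ((List.range' 0 23).map fun i =>
    ((List.range' 0 273).filter fun j => i < j ∧ (j ∈ flipTgtList i ∨
      (j = 265 ∧ i ∈ ([262, 263, 264, 266, 267, 268, 269, 270] : List ℕ)) ∨ (i = 265 ∧ j ∈ ([262, 263, 264, 266, 267, 268, 269, 270] : List ℕ)))).length).sum = 191 := by
  decide +kernel

/-- Adjacent-pair count, chunk 1 (`23 ≤ i < 46`; kernel evaluation). [cite: KauersMoosbauer2022FlipGraphs, §4 ("1183 edges")] -/
theorem adjPairs_1 : ((List.range' 23 23).map fun i =>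
    ((List.range' 0 273).filter fun j => i < j ∧ (j ∈ flipTgtList i ∨
      (j = 265 ∧ i ∈ ([262, 263, 264, 266, 267, 268, 269, 270] : List ℕ)) ∨ (i = 265 ∧ j ∈ ([262, 263, 264, 266, 267, 268, 269, 270] : List ℕ)))).length).sum = 167 := by
  decide +kernel

/-- Adjacent-pair count, chunk 2 (`46 ≤ i < 92`; kernel evaluation). [cite: KauersMoosbauer2022FlipGraphs, §4 ("1183 edges")] -/
theorem adjPairs_2 : ((List.range' 46 46).map fun i =>
    ((List.range' 0 273).filter fun j => i < j ∧ (j ∈ flipTgtList i ∨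
      (j = 265 ∧ i ∈ ([262, 263, 264, 266, 267, 268, 269, 270] : List ℕ)) ∨ (i = 265 ∧ j ∈ ([262, 263, 264, 266, 267, 268, 269, 270] : List ℕ)))).length).sum = 226 := by
  decide +kernel

/-- Adjacent-pair count, chunk 3 (`92 ≤ i < 138`; kernel evaluation). [cite: KauersMoosbauer2022FlipGraphs, §4 ("1183 edges")] -/
theorem adjPairs_3 : ((List.range' 92 46).map fun i =>
    ((List.range' 0 273).filter fun j => i < j ∧ (j ∈ flipTgtList i ∨
      (j = 265 ∧ i ∈ ([262, 263, 264, 266, 267, 268, 269, 270] : List ℕ)) ∨ (i = 265 ∧ j ∈ ([262, 263, 264, 266, 267, 268, 269, 270] : List ℕ)))).length).sum = 218 := by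
  decide +kernel

/-- Adjacent-pair count, chunk 4 (`138 ≤ i < 184`; kernel evaluation). [cite: KauersMoosbauer2022FlipGraphs, §4 ("1183 edges")] -/
theorem adjPairs_4 : ((List.range' 138 46).map fun i =>
    ((List.range' 0 273).filter fun j => i < j ∧ (j ∈ flipTgtList i ∨
      (j = 265 ∧ i ∈ ([262, 263, 264, 266, 267, 268, 269, 270] : List ℕ)) ∨ (i = 265 ∧ j ∈ ([262, 263, 264, 266, 267, 268, 269, 270] : List ℕ)))).length).sum = 173 := by
  decide +kernel

/-- Adjacent-pair count, chunk 5 (`184 ≤ i < 230`; kernel evaluation). [cite: KauersMoosbauer2022FlipGraphs, §4 ("1183 edges")] -/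
theorem adjPairs_5 : ((List.range' 184 46).map fun i =>
    ((List.range' 0 273).filter fun j => i < j ∧ (j ∈ flipTgtList i ∨
      (j = 265 ∧ i ∈ ([262, 263, 264, 266, 267, 268, 269, 270] : List ℕ)) ∨ (i = 265 ∧ j ∈ ([262, 263, 264, 266, 267, 268, 269, 270] : List ℕ)))).length).sum = 119 := by
  decide +kernel

/-- Adjacent-pair count, chunk 6 (`230 ≤ i < 273`; kernel evaluation). [cite: KauersMoosbauer2022FlipGraphs, §4 ("1183 edges")] -/
theorem adjPairs_6 : ((List.range' 230 43).map fun i =>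
    ((List.range' 0 273).filter fun j => i < j ∧ (j ∈ flipTgtList i ∨
      (j = 265 ∧ i ∈ ([262, 263, 264, 266, 267, 268, 269, 270] : List ℕ)) ∨ (i = 265 ∧ j ∈ ([262, 263, 264, 266, 267, 268, 269, 270] : List ℕ)))).length).sum = 50 := by
  decide +kernel

/-- **`1144 = 1136 + 8` unordered pairs `i < j` of vertices of the component are adjacent in
`flipGraph222LE8`** (the condition of `adj_cv_iff`; the seven kernel chunks): `1136` flip pairs and
the `8` reduction edges into Strassen's orbit. With KM's conventions (`40` loops counted, `7`
reductions in their data) the printed total is `1136 + 40 + 7 = 1183`; the component itself has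
`1136 + 40 + 8 = 1184` such edges. [cite: KauersMoosbauer2022FlipGraphs, §4 ("1183 edges, 7 of which are reductions")] -/
theorem adjPairs_card : ((List.range 273).map fun i =>
    ((List.range' 0 273).filter fun j => i < j ∧ (j ∈ flipTgtList i ∨
      (j = 265 ∧ i ∈ ([262, 263, 264, 266, 267, 268, 269, 270] : List ℕ)) ∨ (i = 265 ∧ j ∈ ([262, 263, 264, 266, 267, 268, 269, 270] : List ℕ)))).length).sum = 1144 := by
  rw [range273_split]
  simp only [List.map_append, List.sum_append, adjPairs_0, adjPairs_1, adjPairs_2, adjPairs_3,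
    adjPairs_4, adjPairs_5, adjPairs_6]

end Comp222

end FlipGraph

end Literature.Computability.AlgebraicComplexity
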